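import Summits.Schanuel.Schanuel.Theorems.ZilberEacDegenerateDirectionDensity
import Summits.Schanuel.Schanuel.Theorems.ZilberEacRelationGraphFibreSurface
import HarnessLib

/-!
# The exponential-polynomial regime, CXIII: MANTOVA–MASSER'S EXAMPLE (fermat) ITSELF —
# `{x₀ⁿ + x₁ⁿ = 1, y₀ + y₁ = 1}` is in their case AND its exponential points are Zariski dense

HONEST FRAMING.  Cell `pub-schanuel` (Zilber's Exponential-Algebraic Closedness, case ladder;
host summit Schanuel), seat 2, gen 34.  Mantova–Masser, PLMS 2024 §1 "Further remarks" (p. 5):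
"Just for the example (fermat) [`X₁⁹ + X₂⁹ = 1`, `X̂₁ + X̂₂ = 1`] the density in `S` would amount
to the fact that there is no `G ≠ 0` in `ℂ[X₁, X̂₁]` such that `G(z, e^z) = 0` for all `z` with
`e^z + e^{⁹√(1−z⁹)} = 1`, which does not seem obvious."  **`unprojectedDensityQuestion_fermat_unitLine`**:
for every `n ≥ 2`, the surface `W = {x₀ⁿ + x₁ⁿ = 1, y₀ = 1 − y₁} ⊆ ℂ² × ℂ²` satisfies the
hypotheses of their case (dim-π-S-1-free) AND `I(W ∩ Γ_exp) = I(W)` — the unprojected exponential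
points are Zariski dense in `W`; `n = 9` (**`unprojectedDensityQuestion_mantovaMasser_fermat`**) is
their example verbatim.  Proof: the certificate of file CXII (`y₀ = R(x, y₁)` with `R = 1 − y₁`)
and the S-form density of file CXI (degenerate direction `x₀ ∈ 2πiℕ`, `y₁ → 0` along the place
`x₁ = e^{iπ/n}(1 − sⁿ)^{1/n}/s`, perturbation of the degenerate relation `y₀ = 1`).  This decides
ONE example (for all exponents) of an OPEN question; the question in general, EC(3,2) and
Zilber's EAC remain OPEN; NOT Schanuel's conjecture (neither used nor implied); EAC ⇏ SC.
-/

noncomputable section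

open Set Complex MvPolynomial
open Literature.NumberTheory.Transcendental Literature.ModelTheory.Zilber
open Literature.ModelTheory.ExponentialFields

set_option linter.dupNamespace false

namespace Summit.Schanuel.Schanuel.Theorems

section FermatUnitLine

variable (n : ℕ)

/-- **The Fermat curve is not contained in a line of rational slope** (`n ≥ 2`): for every
`m ∈ ℤ² ∖ 0` and `c`, one of `(1, 0)`, `(0, 1)`, `(ω, 0)` (`ω = e^{2πi/n}`) is a point of
`x₀ⁿ + x₁ⁿ = 1` off the line `m₀x₀ + m₁x₁ = c`. [folklore] -/
theorem fermat_exists_off_rationalLine (hn : 2 ≤ n) (m : Fin 2 → ℤ) (hm : m ≠ 0) (c : ℂ) :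
    ∃ x : Fin 2 → ℂ, MvPolynomial.eval x (X 0 ^ n + X 1 ^ n - 1 : MvPolynomial (Fin 2) ℂ) = 0 ∧
      (m 0 : ℂ) * x 0 + (m 1 : ℂ) * x 1 ≠ c := by
  have hn0 : n ≠ 0 := by omega
  have hω := Complex.isPrimitiveRoot_exp n hn0
  set ω : ℂ := Complex.exp (2 * Real.pi * I / n) with hωdef
  have hωn : ω ^ n = 1 := hω.pow_eq_one
  have hω1 : ω ≠ 1 := hω.ne_one (by omega)
  by_cases h1 : (m 0 : ℂ) * 1 + (m 1 : ℂ) * 0 ≠ c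
  · exact ⟨![1, 0], by rw [eval_fermatMv]; simp [hn0], by simpa using h1⟩
  by_cases h2 : (m 0 : ℂ) * 0 + (m 1 : ℂ) * 1 ≠ c
  · exact ⟨![0, 1], by rw [eval_fermatMv]; simp [hn0], by simpa using h2⟩
  push Not at h1 h2
  refine ⟨![ω, 0], ?_, ?_⟩
  · rw [eval_fermatMv]; simp [hn0, hωn]
  · simp only [Matrix.cons_val_zero, Matrix.cons_val_one, mul_zero, add_zero]
    intro h3
    have hm0c : (m 0 : ℂ) = c := by simpa using h1
    have hm1c : (m 1 : ℂ) = c := by simpa using h2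
    have hc : c * (ω - 1) = 0 := by rw [← hm0c] at h3 ⊢; linear_combination h3 - hm0c + hm0c
    rcases mul_eq_zero.1 hc with hc0 | hω0
    · apply hm
      funext i
      fin_cases i
      · exact_mod_cast (hm0c.trans hc0)
      · exact_mod_cast (hm1c.trans hc0)
    · exact hω1 (by linear_combination hω0)

/-- Evaluation of the fibre relation `1 − y₁ ∈ ℂ[x₀, x₁, y₁]`. -/
theorem eval_oneSubY1 (v : Fin 3 → ℂ) :
    MvPolynomial.eval v (1 - X 2 : MvPolynomial (Fin 3) ℂ) = 1 - v 2 := by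
  simp

variable {n}

/-- **MANTOVA–MASSER'S EXAMPLE SURFACE, every exponent `n ≥ 2`: case ∧ dense.**  The surface
`W = {x₀ⁿ + x₁ⁿ = 1, y₀ = 1 − y₁} ⊆ ℂ² × ℂ²` is in Mantova–Masser's case (dim-π-S-1-free) and
`I(W ∩ Γ_exp) = I(W)`: its unprojected exponential points are Zariski dense.
[cite: MantovaMasser2023, §1 Further remarks, p. 5 (the example (fermat); the question, open in
general)] (new) -/
theorem unprojectedDensityQuestion_fermat_unitLine (hn : 2 ≤ n) :
    MMCaseDimPiOneFree {w : Fin 2 ⊕ Fin 2 → ℂ |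
        MvPolynomial.eval ![w (Sum.inl 0), w (Sum.inl 1)]
          (X 0 ^ n + X 1 ^ n - 1 : MvPolynomial (Fin 2) ℂ) = 0 ∧
        w (Sum.inr 0) = MvPolynomial.eval ![w (Sum.inl 0), w (Sum.inl 1), w (Sum.inr 1)]
          (1 - X 2 : MvPolynomial (Fin 3) ℂ)} ∧
      UnprojectedDense {w : Fin 2 ⊕ Fin 2 → ℂ |
        MvPolynomial.eval ![w (Sum.inl 0), w (Sum.inl 1)]
          (X 0 ^ n + X 1 ^ n - 1 : MvPolynomial (Fin 2) ℂ) = 0 ∧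
        w (Sum.inr 0) = MvPolynomial.eval ![w (Sum.inl 0), w (Sum.inl 1), w (Sum.inr 1)]
          (1 - X 2 : MvPolynomial (Fin 3) ℂ)} := by
  have hn1 : 1 ≤ n := by omega
  have hn0 : n ≠ 0 := by omega
  have hirr := irreducible_fermatMv n hn1
  refine ⟨mmCase_relGraphFibre (R := (1 - X 2 : MvPolynomial (Fin 3) ℂ)) hirr ?_
      (fermat_exists_off_rationalLine n hn), ?_⟩
  · refine ⟨![1, 0], 2, by rw [eval_fermatMv]; simp [hn0], two_ne_zero, ?_⟩
    rw [eval_oneSubY1]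
    show (1 : ℂ) - 2 ≠ 0
    norm_num
  · refine unprojectedDense_fermat_unitLine hn (isIrreducibleClosed_relGraphFibre _ hirr)
      (le_of_eq (zariskiDim_relGraphFibre _ hirr)) fun x₀ x₁ y hF hy => ⟨?_, ?_⟩
    · simp only [Sum.elim_inl, Matrix.cons_val_zero, Matrix.cons_val_one]
      rw [eval_fermatMv]
      simp only [Matrix.cons_val_zero, Matrix.cons_val_one]
      linear_combination hF
    · simp only [Sum.elim_inr, Sum.elim_inl, Matrix.cons_val_zero, Matrix.cons_val_one]
      rw [eval_oneSubY1]
      have h2 : (![x₀, x₁, Complex.exp x₁] : Fin 3 → ℂ) 2 = Complex.exp x₁ := rfl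
      rw [h2]
      linear_combination hy

/-- **Plain coordinates.**  `{x₀ⁿ + x₁ⁿ = 1, y₀ + y₁ = 1}` (`n ≥ 2`) is in Mantova–Masser's case AND
its exponential points are Zariski dense. [cite: MantovaMasser2023, §1 Further remarks, p. 5
(the example (fermat); the question, open in general)] (new) -/
theorem unprojectedDensityQuestion_fermat_unitLine' (hn : 2 ≤ n) :
    MMCaseDimPiOneFree {w : Fin 2 ⊕ Fin 2 → ℂ |
        w (Sum.inl 0) ^ n + w (Sum.inl 1) ^ n = 1 ∧ w (Sum.inr 0) + w (Sum.inr 1) = 1} ∧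
      UnprojectedDense {w : Fin 2 ⊕ Fin 2 → ℂ |
        w (Sum.inl 0) ^ n + w (Sum.inl 1) ^ n = 1 ∧ w (Sum.inr 0) + w (Sum.inr 1) = 1} := by
  have e : {w : Fin 2 ⊕ Fin 2 → ℂ |
        MvPolynomial.eval ![w (Sum.inl 0), w (Sum.inl 1)]
          (X 0 ^ n + X 1 ^ n - 1 : MvPolynomial (Fin 2) ℂ) = 0 ∧
        w (Sum.inr 0) = MvPolynomial.eval ![w (Sum.inl 0), w (Sum.inl 1), w (Sum.inr 1)]
          (1 - X 2 : MvPolynomial (Fin 3) ℂ)} =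
      {w : Fin 2 ⊕ Fin 2 → ℂ |
        w (Sum.inl 0) ^ n + w (Sum.inl 1) ^ n = 1 ∧ w (Sum.inr 0) + w (Sum.inr 1) = 1} := by
    ext w
    simp only [Set.mem_setOf_eq, eval_fermatMv, eval_oneSubY1, Matrix.cons_val_zero,
      Matrix.cons_val_one]
    have h2 : (![w (Sum.inl 0), w (Sum.inl 1), w (Sum.inr 1)] : Fin 3 → ℂ) 2 = w (Sum.inr 1) := rfl
    rw [h2]
    constructor
    · rintro ⟨h1, h2⟩
      exact ⟨by linear_combination h1, by linear_combination h2⟩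
    · rintro ⟨h1, h2⟩
      exact ⟨by linear_combination h1, by linear_combination h2⟩
  have h := unprojectedDensityQuestion_fermat_unitLine hn
  rw [e] at h
  exact h

/-- **MANTOVA–MASSER'S EXAMPLE (fermat) VERBATIM: `{X₁⁹ + X₂⁹ = 1, X̂₁ + X̂₂ = 1}` is in their case
(dim-π-S-1-free) AND its unprojected exponential points are Zariski dense** — their density
question (PLMS 2024 §1 p. 5) answered YES for the example they flag.
[cite: MantovaMasser2023, §1 Further remarks, p. 5 (the example (fermat))] (new) -/
theorem unprojectedDensityQuestion_mantovaMasser_fermat :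
    MMCaseDimPiOneFree {w : Fin 2 ⊕ Fin 2 → ℂ |
        w (Sum.inl 0) ^ 9 + w (Sum.inl 1) ^ 9 = 1 ∧ w (Sum.inr 0) + w (Sum.inr 1) = 1} ∧
      UnprojectedDense {w : Fin 2 ⊕ Fin 2 → ℂ |
        w (Sum.inl 0) ^ 9 + w (Sum.inl 1) ^ 9 = 1 ∧ w (Sum.inr 0) + w (Sum.inr 1) = 1} :=
  unprojectedDensityQuestion_fermat_unitLine' (by norm_num)

end FermatUnitLine

end Summit.Schanuel.Schanuel.Theorems

end
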